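import Summits.ValiantsHypothesis.ValiantsHypothesis.Theorems.KPlusLogSqLawTridiagonalRealStaticLadderRung
import Summits.ValiantsHypothesis.ValiantsHypothesis.Theorems.KPlusLogSqLawTridiagonalRealStatic

/-!
# Route «KPlusLogSqLaw», crux `WeakLifting` (stmt-ValiantsHypothesis-19561) — REAL side of the tridiagonal sector:
# THE ANALYTIC LADDER FOR ALL SIZES — a static definite tridiagonal `(2k+3) × (2k+3)` monomial matrix with `≥ 3k+1` positive zeros (kernel slope `3/2`)

HONEST FRAMING.  Helper (`--supports stmt-ValiantsHypothesis-19561 --as helper`), seat val-sym-lift-p1 (g12), cell `pub-symmetroid`,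
2026-08-27, in the typed currency of the desk's α target of record `staticTridiagonal_definite_posRoots_le` (lead R2102/R2114).  LOWER side
only.  This file ITERATES the rung of `…LadderRung` from an explicit size-`3` base and realises the continuants as determinants:
* the continuants are the determinants of the path matrices `ctPath (X) (b_t X^{f_t}) (b_{t−1} X^{f_{t−1}})` (diagonal entries `X`,
  symmetric links `b_t X^{f_t}`), evaluated at `x > 0`; `eval_det_path_add_two` is the three-term recurrence
  `D_{n+2} = x·D_{n+1} − b_n² x^{2f_n}·D_n` (the tree's continuant normal form `det_ctPath`, lift-p3 g8);
* `ladder_base`: the data `b ≡ 1, f ≡ 0` at sizes `2, 3` (`D₂ = x² − 1`, `D₃ = x³ − 2x`) are a ladder state with ONE certified alternation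
  (sample points `1/2, 2`; structural points `1/2 < 3/4 < 5/4 < 2`, sign `−1`);
* `ladder_iter`: after `k` rungs (each appends two hierarchical edges `√κ·X^f` from `rung`) the pair `(D_{2k+2}, D_{2k+3})` is a ladder
  state with `3k + 1` certified alternations;
* `exists_static_definite_tridiagonal_ladder`: hence for EVERY `k` a static definite symmetric tridiagonal `(2k+3) × (2k+3)` monomial
  matrix (R2114 currency: `c`, `e` symmetric, `c = 0` off the band, `c i i = 1 > 0`) with at least `3k + 1` distinct positive determinant
  zeros; `threeHalves_le_of_definiteRow_odd` / `threeHalves_le_slope`: every admissible law has `B (2k+3) ≥ 3k+1`, and every real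
  linear law `A·m + A₀` on the sector has `A ≥ 3/2` — superseding the glued slopes `4/3` (p571271) and `7/5` (p572962) WITHOUT any
  explicit block beyond size `3` (the rungs' exponents exist by the Archimedean property and are astronomically large: the located
  super-exponential growth of the ladder's slopes is exactly why no explicit all-`m` family could be typed).
Located context: lift-p3 g9's hierarchical LIMIT GAME reaches `2m − 6` (pump-and-harvest) and is capped at `2m − 2`; the same sign-only
framework should carry the pump (slope `2`) — not done here.  Nothing here is an UPPER bound; nothing bears on `WeakLifting` / `TropicalB`
(stmt-19771) in their windows, on Conjecture B, on the Door-A registers, on `MatrixDescartes` (stmt-ValiantsHypothesis-18050) or on VP ≠ VNP.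
[mechanism: this lineage's rotating-detector ladder (memo ROTATING-DETECTOR-liftp1g11.md §3b); folklore analysis and continuants]
-/

-- `Summit.ValiantsHypothesis.ValiantsHypothesis.…` repeats a component by the D-0017 layout (single-conjunct summit); the name is mandated.
set_option linter.dupNamespace false
set_option autoImplicit false

namespace Summit.ValiantsHypothesis.ValiantsHypothesis.Theorems.KPlusLogSqLaw.StaticTridiagonalRealLadder

open Polynomial
open Summit.ValiantsHypothesis.ValiantsHypothesis.Theorems.ValuativeFlip (ctK ctPath ctPath_apply ctK_zero ctK_one ctK_add_two)
open Summit.ValiantsHypothesis.ValiantsHypothesis.Theorems.KPlusLogSqLaw.StaticTridiagonalReal (det_ctPath)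

/-! ### The continuants as determinants of path matrices -/

/-- **Three-term recurrence** of the path determinants with diagonal `X` and symmetric links `b_t X^{f_t}`:
`D_{n+2}(x) = x·D_{n+1}(x) − b_n² x^{2 f_n}·D_n(x)`. [folklore: continuants, via the tree's `det_ctPath`] -/
theorem eval_det_path_add_two (b : ℕ → ℝ) (f : ℕ → ℕ) (n : ℕ) (x : ℝ) :
    (((ctPath (fun _ => (X : ℝ[X])) (fun t => C (b t) * X ^ f t) (fun t => C (b (t - 1)) * X ^ f (t - 1)) (n + 2))).det).eval x =
      x * (((ctPath (fun _ => (X : ℝ[X])) (fun t => C (b t) * X ^ f t) (fun t => C (b (t - 1)) * X ^ f (t - 1)) (n + 1))).det).eval x - b n ^ 2 * x ^ (2 * f n) * (((ctPath (fun _ => (X : ℝ[X])) (fun t => C (b t) * X ^ f t) (fun t => C (b (t - 1)) * X ^ f (t - 1)) n)).det).eval x := by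
  rw [det_ctPath _ _ _ (n + 2), det_ctPath _ _ _ (n + 1), det_ctPath _ _ _ n, ctK_add_two]
  simp only [Nat.add_sub_cancel, eval_add, eval_mul, eval_X, eval_neg, eval_C, eval_pow]
  ring

/-- `D₀ = 1`. [folklore] -/
theorem eval_det_path_zero (b : ℕ → ℝ) (f : ℕ → ℕ) (x : ℝ) : (((ctPath (fun _ => (X : ℝ[X])) (fun t => C (b t) * X ^ f t) (fun t => C (b (t - 1)) * X ^ f (t - 1)) 0)).det).eval x = 1 := by
  rw [Matrix.det_isEmpty, eval_one]

/-- `D₁ = x`. [folklore] -/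
theorem eval_det_path_one (b : ℕ → ℝ) (f : ℕ → ℕ) (x : ℝ) : (((ctPath (fun _ => (X : ℝ[X])) (fun t => C (b t) * X ^ f t) (fun t => C (b (t - 1)) * X ^ f (t - 1)) 1)).det).eval x = x := by
  rw [det_ctPath _ _ _ 1, ctK_one, eval_X]

/-- The path matrix of size `n` only depends on the link data `b_t, f_t` with `t + 1 < n`. [folklore] -/
theorem ctPath_congr_data {b b' : ℕ → ℝ} {f f' : ℕ → ℕ} {n : ℕ} (hb : ∀ t, t + 1 < n → b t = b' t)
    (hf : ∀ t, t + 1 < n → f t = f' t) :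
    (ctPath (fun _ => (X : ℝ[X])) (fun t => C (b t) * X ^ f t) (fun t => C (b (t - 1)) * X ^ f (t - 1)) n) =
      (ctPath (fun _ => (X : ℝ[X])) (fun t => C (b' t) * X ^ f' t) (fun t => C (b' (t - 1)) * X ^ f' (t - 1)) n) := by
  ext x y
  have hx := x.isLt
  have hy := y.isLt
  simp only [ctPath_apply]
  split_ifs with h1 h2 h3
  · rfl
  · rw [hb x (by omega), hf x (by omega)]
  · rw [hb (x - 1) (by omega), hf (x - 1) (by omega)]
  · rfl

/-- the path determinants are continuous functions of `x`. [folklore] -/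
theorem continuous_eval_det_path (b : ℕ → ℝ) (f : ℕ → ℕ) (n : ℕ) :
    Continuous fun x : ℝ => (((ctPath (fun _ => (X : ℝ[X])) (fun t => C (b t) * X ^ f t) (fun t => C (b (t - 1)) * X ^ f (t - 1)) n)).det).eval x :=
  Polynomial.continuous _

/-! ### The base: sizes `2, 3` with links `1, 1` (`D₂ = x² − 1`, `D₃ = x³ − 2x`) -/

/-- `D₂ = x² − 1` for the base data. [data of this seat] -/
theorem eval_det_base_two (x : ℝ) : (((ctPath (fun _ => (X : ℝ[X])) (fun t => C ((fun _ : ℕ => (1 : ℝ)) t) * X ^ (fun _ : ℕ => (0 : ℕ)) t) (fun t => C ((fun _ : ℕ => (1 : ℝ)) (t - 1)) * X ^ (fun _ : ℕ => (0 : ℕ)) (t - 1)) 2)).det).eval x = x ^ 2 - 1 := by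
  have h := eval_det_path_add_two (fun _ : ℕ => (1 : ℝ)) (fun _ : ℕ => (0 : ℕ)) 0 x
  have h1 : (((ctPath (fun _ => (X : ℝ[X])) (fun t => C ((fun _ : ℕ => (1 : ℝ)) t) * X ^ (fun _ : ℕ => (0 : ℕ)) t) (fun t => C ((fun _ : ℕ => (1 : ℝ)) (t - 1)) * X ^ (fun _ : ℕ => (0 : ℕ)) (t - 1)) (0 + 1))).det).eval x = x := eval_det_path_one _ _ x
  rw [h1, eval_det_path_zero] at h
  have h2 : (((ctPath (fun _ => (X : ℝ[X])) (fun t => C ((fun _ : ℕ => (1 : ℝ)) t) * X ^ (fun _ : ℕ => (0 : ℕ)) t) (fun t => C ((fun _ : ℕ => (1 : ℝ)) (t - 1)) * X ^ (fun _ : ℕ => (0 : ℕ)) (t - 1)) 2)).det).eval x = (((ctPath (fun _ => (X : ℝ[X])) (fun t => C ((fun _ : ℕ => (1 : ℝ)) t) * X ^ (fun _ : ℕ => (0 : ℕ)) t) (fun t => C ((fun _ : ℕ => (1 : ℝ)) (t - 1)) * X ^ (fun _ : ℕ => (0 : ℕ)) (t - 1)) (0 + 2))).det).eval x := rfl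
  rw [h2, h]
  ring

/-- `D₃ = x³ − 2x` for the base data. [data of this seat] -/
theorem eval_det_base_three (x : ℝ) : (((ctPath (fun _ => (X : ℝ[X])) (fun t => C ((fun _ : ℕ => (1 : ℝ)) t) * X ^ (fun _ : ℕ => (0 : ℕ)) t) (fun t => C ((fun _ : ℕ => (1 : ℝ)) (t - 1)) * X ^ (fun _ : ℕ => (0 : ℕ)) (t - 1)) 3)).det).eval x = x ^ 3 - 2 * x := by
  have h := eval_det_path_add_two (fun _ : ℕ => (1 : ℝ)) (fun _ : ℕ => (0 : ℕ)) 1 x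
  have h2 : (((ctPath (fun _ => (X : ℝ[X])) (fun t => C ((fun _ : ℕ => (1 : ℝ)) t) * X ^ (fun _ : ℕ => (0 : ℕ)) t) (fun t => C ((fun _ : ℕ => (1 : ℝ)) (t - 1)) * X ^ (fun _ : ℕ => (0 : ℕ)) (t - 1)) (1 + 1))).det).eval x = x ^ 2 - 1 := eval_det_base_two x
  rw [h2, eval_det_path_one] at h
  have h3 : (((ctPath (fun _ => (X : ℝ[X])) (fun t => C ((fun _ : ℕ => (1 : ℝ)) t) * X ^ (fun _ : ℕ => (0 : ℕ)) t) (fun t => C ((fun _ : ℕ => (1 : ℝ)) (t - 1)) * X ^ (fun _ : ℕ => (0 : ℕ)) (t - 1)) 3)).det).eval x = (((ctPath (fun _ => (X : ℝ[X])) (fun t => C ((fun _ : ℕ => (1 : ℝ)) t) * X ^ (fun _ : ℕ => (0 : ℕ)) t) (fun t => C ((fun _ : ℕ => (1 : ℝ)) (t - 1)) * X ^ (fun _ : ℕ => (0 : ℕ)) (t - 1)) (1 + 2))).det).eval x := rfl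
  rw [h3, h]
  ring

/-- **THE BASE STATE**: `(D₂, D₃)` of the base data with sign `−1`, sample list `[1/2, 2]` (one alternation of `D₃ = x(x² − 2)`),
structural points `1/2 < 3/4 < 5/4 < 2` (`D₂ = x² − 1` changes sign at `1`, `D₃` at `√2`; at the zero `1` of `D₂`, `D₃(1) = −1 < 0`).
[data of this seat] -/
theorem ladder_base :
    (((-1 : ℝ) = 1 ∨ (-1 : ℝ) = -1) ∧
      (([] : List ℝ) ++ (1 / 2 : ℝ) :: (2 : ℝ) :: ([] : List ℝ)).IsChain (· < ·) ∧
      (∀ x ∈ (([] : List ℝ) ++ (1 / 2 : ℝ) :: (2 : ℝ) :: ([] : List ℝ)), 0 < x) ∧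
      (([] : List ℝ) ++ (1 / 2 : ℝ) :: (2 : ℝ) :: ([] : List ℝ)).IsChain (fun x y => (((ctPath (fun _ => (X : ℝ[X])) (fun t => C ((fun _ : ℕ => (1 : ℝ)) t) * X ^ (fun _ : ℕ => (0 : ℕ)) t) (fun t => C ((fun _ : ℕ => (1 : ℝ)) (t - 1)) * X ^ (fun _ : ℕ => (0 : ℕ)) (t - 1)) 3)).det).eval x * (((ctPath (fun _ => (X : ℝ[X])) (fun t => C ((fun _ : ℕ => (1 : ℝ)) t) * X ^ (fun _ : ℕ => (0 : ℕ)) t) (fun t => C ((fun _ : ℕ => (1 : ℝ)) (t - 1)) * X ^ (fun _ : ℕ => (0 : ℕ)) (t - 1)) 3)).det).eval y < 0) ∧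
      (1 / 2 : ℝ) < (3 / 4 : ℝ) ∧ (3 / 4 : ℝ) < (5 / 4 : ℝ) ∧ (5 / 4 : ℝ) < (2 : ℝ) ∧
      0 < (-1 : ℝ) * (((ctPath (fun _ => (X : ℝ[X])) (fun t => C ((fun _ : ℕ => (1 : ℝ)) t) * X ^ (fun _ : ℕ => (0 : ℕ)) t) (fun t => C ((fun _ : ℕ => (1 : ℝ)) (t - 1)) * X ^ (fun _ : ℕ => (0 : ℕ)) (t - 1)) 3)).det).eval (1 / 2 : ℝ) ∧ 0 < (-1 : ℝ) * (((ctPath (fun _ => (X : ℝ[X])) (fun t => C ((fun _ : ℕ => (1 : ℝ)) t) * X ^ (fun _ : ℕ => (0 : ℕ)) t) (fun t => C ((fun _ : ℕ => (1 : ℝ)) (t - 1)) * X ^ (fun _ : ℕ => (0 : ℕ)) (t - 1)) 3)).det).eval (3 / 4 : ℝ) ∧ 0 < (-1 : ℝ) * (((ctPath (fun _ => (X : ℝ[X])) (fun t => C ((fun _ : ℕ => (1 : ℝ)) t) * X ^ (fun _ : ℕ => (0 : ℕ)) t) (fun t => C ((fun _ : ℕ => (1 : ℝ)) (t - 1)) *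 X ^ (fun _ : ℕ => (0 : ℕ)) (t - 1)) 3)).det).eval (5 / 4 : ℝ) ∧ (-1 : ℝ) * (((ctPath (fun _ => (X : ℝ[X])) (fun t => C ((fun _ : ℕ => (1 : ℝ)) t) * X ^ (fun _ : ℕ => (0 : ℕ)) t) (fun t => C ((fun _ : ℕ => (1 : ℝ)) (t - 1)) * X ^ (fun _ : ℕ => (0 : ℕ)) (t - 1)) 3)).det).eval (2 : ℝ) < 0 ∧
      0 < (-1 : ℝ) * (((ctPath (fun _ => (X : ℝ[X])) (fun t => C ((fun _ : ℕ => (1 : ℝ)) t) * X ^ (fun _ : ℕ => (0 : ℕ)) t) (fun t => C ((fun _ : ℕ => (1 : ℝ)) (t - 1)) * X ^ (fun _ : ℕ => (0 : ℕ)) (t - 1)) 2)).det).eval (3 / 4 : ℝ) ∧ (-1 : ℝ) * (((ctPath (fun _ => (X : ℝ[X])) (fun t => C ((fun _ : ℕ => (1 : ℝ)) t) * X ^ (fun _ : ℕ => (0 : ℕ)) t) (fun t => C ((fun _ : ℕ => (1 : ℝ)) (t - 1)) * X ^ (fun _ : ℕ => (0 : ℕ)) (t - 1)) 2)).det).eval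 (5 / 4 : ℝ) < 0 ∧
      (∀ z ∈ Set.Icc (3 / 4 : ℝ) (5 / 4 : ℝ), (((ctPath (fun _ => (X : ℝ[X])) (fun t => C ((fun _ : ℕ => (1 : ℝ)) t) * X ^ (fun _ : ℕ => (0 : ℕ)) t) (fun t => C ((fun _ : ℕ => (1 : ℝ)) (t - 1)) * X ^ (fun _ : ℕ => (0 : ℕ)) (t - 1)) 2)).det).eval z = 0 → 0 < (-1 : ℝ) * (((ctPath (fun _ => (X : ℝ[X])) (fun t => C ((fun _ : ℕ => (1 : ℝ)) t) * X ^ (fun _ : ℕ => (0 : ℕ)) t) (fun t => C ((fun _ : ℕ => (1 : ℝ)) (t - 1)) * X ^ (fun _ : ℕ => (0 : ℕ)) (t - 1)) 3)).det).eval z)) := by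
  refine ⟨Or.inr rfl, ?_, ?_, ?_, by norm_num, by norm_num, by norm_num, ?_, ?_, ?_, ?_, ?_, ?_, ?_⟩
  · simp only [List.nil_append, List.isChain_cons_cons, List.isChain_singleton, and_true]; norm_num
  · intro x hx
    simp only [List.nil_append, List.mem_cons, List.not_mem_nil, or_false] at hx
    rcases hx with rfl | rfl <;> norm_num
  · simp only [List.nil_append, List.isChain_cons_cons, List.isChain_singleton, and_true, eval_det_base_three]; norm_num
  · rw [eval_det_base_three]; norm_num
  · rw [eval_det_base_three]; norm_num
  · rw [eval_det_base_three]; norm_num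
  · rw [eval_det_base_three]; norm_num
  · rw [eval_det_base_two]; norm_num
  · rw [eval_det_base_two]; norm_num
  · intro z hz hz0
    rw [eval_det_base_two] at hz0
    rw [eval_det_base_three]
    have hz1 : z ^ 2 = 1 := by linarith
    have hzpos : 0 < z := by linarith [hz.1]
    nlinarith

/-! ### Iterating the rung -/

/-- **AFTER `k` RUNGS**: link data `b, f` (entries `0, 1` the base links `1·X⁰`, then two hierarchical links per rung) such that the path
determinants `(D_{2k+2}, D_{2k+3})` are a ladder state whose sample list has `3k + 2` entries — `3k + 1` certified sign alternations of
`D_{2k+3}`. [this lineage's ladder; folklore analysis] -/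
theorem ladder_iter (k : ℕ) : ∃ (b : ℕ → ℝ) (f : ℕ → ℕ) (s : ℝ) (pre suf : List ℝ) (ℓ α β γ : ℝ),
    pre.length + suf.length = 3 * k ∧
    ((s = 1 ∨ s = -1) ∧
      (pre ++ ℓ :: γ :: suf).IsChain (· < ·) ∧
      (∀ x ∈ (pre ++ ℓ :: γ :: suf), 0 < x) ∧
      (pre ++ ℓ :: γ :: suf).IsChain (fun x y => (((ctPath (fun _ => (X : ℝ[X])) (fun t => C (b t) * X ^ f t) (fun t => C (b (t - 1)) * X ^ f (t - 1)) (2 * k + 3))).det).eval x * (((ctPath (fun _ => (X : ℝ[X])) (fun t => C (b t) * X ^ f t) (fun t => C (b (t - 1)) * X ^ f (t - 1)) (2 * k + 3))).det).eval y < 0) ∧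
      ℓ < α ∧ α < β ∧ β < γ ∧
      0 < s * (((ctPath (fun _ => (X : ℝ[X])) (fun t => C (b t) * X ^ f t) (fun t => C (b (t - 1)) * X ^ f (t - 1)) (2 * k + 3))).det).eval ℓ ∧ 0 < s * (((ctPath (fun _ => (X : ℝ[X])) (fun t => C (b t) * X ^ f t) (fun t => C (b (t - 1)) * X ^ f (t - 1)) (2 * k + 3))).det).eval α ∧ 0 < s * (((ctPath (fun _ => (X : ℝ[X])) (fun t => C (b t) * X ^ f t) (fun t => C (b (t - 1)) * X ^ f (t - 1)) (2 * k + 3))).det).eval β ∧ s * (((ctPath (fun _ => (X : ℝ[X])) (fun t => C (b t) * X ^ f t) (fun t => C (b (t - 1)) * X ^ f (t - 1)) (2 * k + 3))).det).eval γ < 0 ∧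
      0 < s * (((ctPath (fun _ => (X : ℝ[X])) (fun t => C (b t) * X ^ f t) (fun t => C (b (t - 1)) * X ^ f (t - 1)) (2 * k + 2))).det).eval α ∧ s * (((ctPath (fun _ => (X : ℝ[X])) (fun t => C (b t) * X ^ f t) (fun t => C (b (t - 1)) * X ^ f (t - 1)) (2 * k + 2))).det).eval β < 0 ∧
      (∀ z ∈ Set.Icc α β, (((ctPath (fun _ => (X : ℝ[X])) (fun t => C (b t) * X ^ f t) (fun t => C (b (t - 1)) * X ^ f (t - 1)) (2 * k + 2))).det).eval z = 0 → 0 < s * (((ctPath (fun _ => (X : ℝ[X])) (fun t => C (b t) * X ^ f t) (fun t => C (b (t - 1)) * X ^ f (t - 1)) (2 * k + 3))).det).eval z)) := by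
  induction k with
  | zero =>
    exact ⟨(fun _ : ℕ => (1 : ℝ)), (fun _ : ℕ => (0 : ℕ)), -1, [], [], 1 / 2, 3 / 4, 5 / 4, 2, rfl, ladder_base⟩
  | succ k ih =>
    obtain ⟨b, f, s, pre, suf, ℓ, α, β, γ, hlen, hs, hincr, hpos, halt, hℓα, hαβ, hβγ, pℓ, pα, pβ, pγ, qα, qβ, key⟩ := ih
    obtain ⟨f₁, κ₁, f₂, κ₂, hκ₁, hκ₂, ℓ', β', γ', v', hnew⟩ :=
      rung (continuous_eval_det_path b f (2 * k + 2)) (continuous_eval_det_path b f (2 * k + 3))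
        hs hincr hpos halt hℓα hαβ hβγ pℓ pα pβ pγ qα qβ key
    -- the extended link data
    obtain ⟨b', hb'⟩ : ∃ b' : ℕ → ℝ,
        b' = fun t => if t < 2 * k + 2 then b t else if t = 2 * k + 2 then Real.sqrt κ₁ else Real.sqrt κ₂ := ⟨_, rfl⟩
    obtain ⟨f', hf'⟩ : ∃ f' : ℕ → ℕ, f' = fun t => if t < 2 * k + 2 then f t else if t = 2 * k + 2 then f₁ else f₂ := ⟨_, rfl⟩
    have hb'2 : b' (2 * k + 2) ^ 2 = κ₁ := by
      rw [hb']; simp only [lt_irrefl, if_false, if_true]; exact Real.sq_sqrt hκ₁.le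
    have hb'3 : b' (2 * k + 3) ^ 2 = κ₂ := by
      rw [hb']
      simp only [show ¬ (2 * k + 3 < 2 * k + 2) by omega, show (2 * k + 3 ≠ 2 * k + 2) by omega, if_false]
      exact Real.sq_sqrt hκ₂.le
    have hf'2 : f' (2 * k + 2) = f₁ := by rw [hf']; simp only [lt_irrefl, if_false, if_true]
    have hf'3 : f' (2 * k + 3) = f₂ := by
      rw [hf']; simp only [show ¬ (2 * k + 3 < 2 * k + 2) by omega, show (2 * k + 3 ≠ 2 * k + 2) by omega, if_false]
    -- the old sizes are unchanged
    have hagree : ∀ n, n ≤ 2 * k + 3 →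
        (ctPath (fun _ => (X : ℝ[X])) (fun t => C (b' t) * X ^ f' t) (fun t => C (b' (t - 1)) * X ^ f' (t - 1)) n) =
          (ctPath (fun _ => (X : ℝ[X])) (fun t => C (b t) * X ^ f t) (fun t => C (b (t - 1)) * X ^ f (t - 1)) n) := by
      intro n hn
      refine ctPath_congr_data (fun t ht => ?_) (fun t ht => ?_)
      · rw [hb']; simp only [show t < 2 * k + 2 by omega, if_true]
      · rw [hf']; simp only [show t < 2 * k + 2 by omega, if_true]
    have hD2 : ∀ x : ℝ, (((ctPath (fun _ => (X : ℝ[X])) (fun t => C (b' t) * X ^ f' t) (fun t => C (b' (t - 1)) * X ^ f' (t - 1)) (2 * k + 2))).det).eval x = (((ctPath (fun _ => (X : ℝ[X])) (fun t => C (b t) * X ^ f t) (fun t => C (b (t - 1)) * X ^ f (t - 1)) (2 * k + 2))).det).eval x := by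
      intro x; rw [hagree _ (by omega)]
    have hD3 : ∀ x : ℝ, (((ctPath (fun _ => (X : ℝ[X])) (fun t => C (b' t) * X ^ f' t) (fun t => C (b' (t - 1)) * X ^ f' (t - 1)) (2 * k + 3))).det).eval x = (((ctPath (fun _ => (X : ℝ[X])) (fun t => C (b t) * X ^ f t) (fun t => C (b (t - 1)) * X ^ f (t - 1)) (2 * k + 3))).det).eval x := by
      intro x; rw [hagree _ le_rfl]
    -- the two new sizes are the two moves
    have hD4 : ∀ x : ℝ, (((ctPath (fun _ => (X : ℝ[X])) (fun t => C (b' t) * X ^ f' t) (fun t => C (b' (t - 1)) * X ^ f' (t - 1)) (2 * (k + 1) + 2))).det).eval x =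
        x * (((ctPath (fun _ => (X : ℝ[X])) (fun t => C (b t) * X ^ f t) (fun t => C (b (t - 1)) * X ^ f (t - 1)) (2 * k + 3))).det).eval x - κ₁ * x ^ (2 * f₁) * (((ctPath (fun _ => (X : ℝ[X])) (fun t => C (b t) * X ^ f t) (fun t => C (b (t - 1)) * X ^ f (t - 1)) (2 * k + 2))).det).eval x := by
      intro x
      have h := eval_det_path_add_two b' f' (2 * k + 2) x
      rw [hb'2, hf'2, hD2] at h
      have h3 : (((ctPath (fun _ => (X : ℝ[X])) (fun t => C (b' t) * X ^ f' t) (fun t => C (b' (t - 1)) * X ^ f' (t - 1)) (2 * k + 2 + 1))).det).eval x = (((ctPath (fun _ => (X : ℝ[X])) (fun t => C (b t) * X ^ f t) (fun t => C (b (t - 1)) * X ^ f (t - 1)) (2 * k + 3))).det).eval x := by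
        rw [hagree _ (by omega)]
      rw [h3] at h
      exact h
    have hD5 : ∀ x : ℝ, (((ctPath (fun _ => (X : ℝ[X])) (fun t => C (b' t) * X ^ f' t) (fun t => C (b' (t - 1)) * X ^ f' (t - 1)) (2 * (k + 1) + 3))).det).eval x =
        x * (x * (((ctPath (fun _ => (X : ℝ[X])) (fun t => C (b t) * X ^ f t) (fun t => C (b (t - 1)) * X ^ f (t - 1)) (2 * k + 3))).det).eval x - κ₁ * x ^ (2 * f₁) * (((ctPath (fun _ => (X : ℝ[X])) (fun t => C (b t) * X ^ f t) (fun t => C (b (t - 1)) * X ^ f (t - 1)) (2 * k + 2))).det).eval x)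
          - κ₂ * x ^ (2 * f₂) * (((ctPath (fun _ => (X : ℝ[X])) (fun t => C (b t) * X ^ f t) (fun t => C (b (t - 1)) * X ^ f (t - 1)) (2 * k + 3))).det).eval x := by
      intro x
      have h := eval_det_path_add_two b' f' (2 * k + 3) x
      rw [hb'3, hf'3, hD3] at h
      have h4 : (((ctPath (fun _ => (X : ℝ[X])) (fun t => C (b' t) * X ^ f' t) (fun t => C (b' (t - 1)) * X ^ f' (t - 1)) (2 * k + 3 + 1))).det).eval x =
          x * (((ctPath (fun _ => (X : ℝ[X])) (fun t => C (b t) * X ^ f t) (fun t => C (b (t - 1)) * X ^ f (t - 1)) (2 * k + 3))).det).eval x - κ₁ * x ^ (2 * f₁) * (((ctPath (fun _ => (X : ℝ[X])) (fun t => C (b t) * X ^ f t) (fun t => C (b (t - 1)) * X ^ f (t - 1)) (2 * k + 2))).det).eval x := hD4 x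
      rw [h4] at h
      exact h
    refine ⟨b', f', -s, pre ++ [ℓ], v' :: γ :: suf, ℓ', α, β', γ', by simp; omega, ?_⟩
    simp only [hD4, hD5]
    exact hnew

/-! ### Realisation in the R2114 currency and the corollaries -/

/-- **THE ANALYTIC LADDER (all sizes `2k + 3`)**: for every `k` there is a STATIC DEFINITE symmetric tridiagonal `(2k+3) × (2k+3)` matrix
of monomials `c i j · X ^ (e i j)` (`c`, `e` symmetric, `c = 0` off the band, diagonal coefficients `1 > 0`; diagonal entries `X`, links
`b_t X^{f_t}`) whose determinant has at least `3k + 1` distinct positive zeros. [this lineage's ladder; folklore] -/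
theorem exists_static_definite_tridiagonal_ladder (k : ℕ) :
    ∃ (c : Fin (2 * k + 3) → Fin (2 * k + 3) → ℝ) (e : Fin (2 * k + 3) → Fin (2 * k + 3) → ℕ),
      (∀ i j, c i j = c j i) ∧ (∀ i j, e i j = e j i) ∧
      (∀ i j : Fin (2 * k + 3), (i : ℕ) + 1 < j ∨ (j : ℕ) + 1 < i → c i j = 0) ∧ (∀ i, 0 < c i i) ∧
      3 * k + 1 ≤ ((Matrix.det (Matrix.of fun i j => C (c i j) * (X : ℝ[X]) ^ e i j)).roots.toFinset.filter
        (fun t : ℝ => 0 < t)).card := by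
  obtain ⟨b, f, s, pre, suf, ℓ, α, β, γ, hlen, _hs, hincr, hpos, halt, -⟩ := ladder_iter k
  refine ⟨fun i j => if (j : ℕ) = i then 1 else if (j : ℕ) = i + 1 then b i else if (i : ℕ) = j + 1 then b j else 0,
    fun i j => if (j : ℕ) = i then 1 else if (j : ℕ) = i + 1 then f i else if (i : ℕ) = j + 1 then f j else 0,
    ?_, ?_, ?_, ?_, ?_⟩
  · intro i j
    dsimp only
    split_ifs <;> first | rfl | (exfalso; omega)
  · intro i j
    dsimp only
    split_ifs <;> first | rfl | (exfalso; omega)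
  · intro i j hij
    dsimp only
    split_ifs <;> first | rfl | (exfalso; omega)
  · intro i; simp
  · -- the monomial matrix IS the path matrix of the ladder data
    have hM : (Matrix.of fun i j : Fin (2 * k + 3) =>
        C ((if (j : ℕ) = i then 1 else if (j : ℕ) = i + 1 then b i else if (i : ℕ) = j + 1 then b j else 0 : ℝ)) *
          (X : ℝ[X]) ^ (if (j : ℕ) = i then 1 else if (j : ℕ) = i + 1 then f i else if (i : ℕ) = j + 1 then f j else 0 : ℕ)) =
        (ctPath (fun _ => (X : ℝ[X])) (fun t => C (b t) * X ^ f t) (fun t => C (b (t - 1)) * X ^ f (t - 1)) (2 * k + 3)) := by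
      ext i j
      simp only [Matrix.of_apply, ctPath_apply]
      split_ifs with h1 h2 h3
      · simp
      · rfl
      · have : (i : ℕ) - 1 = j := by omega
        rw [this]
      · simp
    rw [hM]
    have hcount := le_card_posRoots_of_isChain ((ctPath (fun _ => (X : ℝ[X])) (fun t => C (b t) * X ^ f t) (fun t => C (b (t - 1)) * X ^ f (t - 1)) (2 * k + 3))).det
      (pre ++ ℓ :: γ :: suf) hincr hpos halt
    have hl : (pre ++ ℓ :: γ :: suf).length - 1 = 3 * k + 1 := by simp; omega
    rw [hl] at hcount
    exact hcount

/-- **Every admissible law on the sector has `3k + 1 ≤ B (2k + 3)` for all `k`** (kernel slope `≥ 3/2` along the odd sizes). [corollary] -/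
theorem threeHalves_le_of_definiteRow_odd (B : ℕ → ℕ)
    (hB : ∀ (m : ℕ) (c : Fin m → Fin m → ℝ) (e : Fin m → Fin m → ℕ), (∀ i j, c i j = c j i) → (∀ i j, e i j = e j i) →
        (∀ i j : Fin m, (i : ℕ) + 1 < j ∨ (j : ℕ) + 1 < i → c i j = 0) → (∀ i, 0 < c i i) →
        ((Matrix.det (Matrix.of fun i j => C (c i j) * (X : ℝ[X]) ^ e i j)).roots.toFinset.filter
          (fun t : ℝ => 0 < t)).card ≤ B m)
    (k : ℕ) : 3 * k + 1 ≤ B (2 * k + 3) := by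
  obtain ⟨c, e, hc, he, hband, hpos, hcard⟩ := exists_static_definite_tridiagonal_ladder k
  exact hcard.trans (hB _ c e hc he hband hpos)

/-- **Every real linear law `Z ≤ A·m + A₀` on the static definite tridiagonal sector has `A ≥ 3/2`** — superseding the glued kernel
slopes `4/3` (p571271) and `7/5` (p572962). [corollary, Archimedean] -/
theorem threeHalves_le_slope (A A₀ : ℝ)
    (hB : ∀ (m : ℕ) (c : Fin m → Fin m → ℝ) (e : Fin m → Fin m → ℕ), (∀ i j, c i j = c j i) → (∀ i j, e i j = e j i) →
        (∀ i j : Fin m, (i : ℕ) + 1 < j ∨ (j : ℕ) + 1 < i → c i j = 0) → (∀ i, 0 < c i i) →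
        (((Matrix.det (Matrix.of fun i j => C (c i j) * (X : ℝ[X]) ^ e i j)).roots.toFinset.filter
          (fun t : ℝ => 0 < t)).card : ℝ) ≤ A * m + A₀) :
    3 / 2 ≤ A := by
  by_contra hA
  push Not at hA
  have key : ∀ k : ℕ, (3 : ℝ) * k + 1 ≤ A * (2 * k + 3) + A₀ := by
    intro k
    obtain ⟨c, e, hc, he, hband, hpos, hcard⟩ := exists_static_definite_tridiagonal_ladder k
    have h1 := hB _ c e hc he hband hpos
    have h2 : ((3 * k + 1 : ℕ) : ℝ) ≤ A * ((2 * k + 3 : ℕ) : ℝ) + A₀ := le_trans (by exact_mod_cast hcard) h1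
    push_cast at h2
    linarith
  have hpos : 0 < 3 - 2 * A := by linarith
  obtain ⟨n, hn⟩ := exists_nat_gt ((3 * A + A₀) / (3 - 2 * A))
  have hk := key n
  rw [div_lt_iff₀ hpos] at hn
  nlinarith

end Summit.ValiantsHypothesis.ValiantsHypothesis.Theorems.KPlusLogSqLaw.StaticTridiagonalRealLadder
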